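import Literature.NumberTheory.GaloisRepresentations.ConjugationDescent
import HarnessLib

/-!
# `H¹(G, M) = Hom_G(N, M)` for an open normal subgroup acting trivially, `(G : N)` invertible on `M`
# (cell `b2b-bsdres`, team n1011, row T-EPC = Tate's local Euler–Poincaré characteristic; seat p04 GEN 8; stage C1)

HONEST FRAMING (cell `b2b-bsdres`, run/shared/lean/b2b/bsd-rank1-residual/, verbatim in every
file): the goal of the cell is to DELETE the COMBINATION-SHAPED residual classes of the
Birch–Swinnerton-Dyer formula for ALL analytic-rank `≤ 1` elliptic curves over `ℚ` — "full BSD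
formula for every rank `≤ 1` curve in class `C`" assembled STRICTLY from published theorems — so
that the rank-`≤ 1` remainder becomes exactly the CONSTRUCTION-SHAPED classes, which are TYPED
(missing-input `Prop`s), NOT attempted. This is not "finishing BSD". Team n1011 (N10 / N11, the
additive block X4 ∧ `p = 3`): research route; no claim beyond the stated classes; nothing is
booked; no mark / label is changed by this file. Theorems only (no definition, no named fact, no
`sorry`); TOOL theorems of profinite group cohomology.  (Placement: Summits/GaloisImage with the
rest of the T-EPC cone.)

## What

Stage C of the T-EPC programme computes `h¹(K, W)` over the tame layer: `Γ = Γ_K ⊳ N = Γ_E`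
open of index prime to `p`, `W` a finite discrete `Γ`-module killed by `p` on which `N` acts
trivially.  Then (Serre, *Corps locaux* VII §6 / *Cohomologie galoisienne* I §2.4 Prop. 9:
`res : H¹(Γ, W) → H¹(N, W)^{Γ/N}` is an isomorphism when `(Γ : N)` is invertible on `W` — the
tree's `ConjugationDescent`) and `H¹(N, W) = Hom_cont(N, W)` (no coboundaries for a trivial
action), so that `H¹(Γ, W)` "is" the group of continuous homomorphisms `φ : N → W` with
`φ(g⁻¹ n g) = g⁻¹ φ(n)`.  This file proves the counted form, for any topological group `G`, open
normal subgroup `N` of finite index and discrete `G`-module `M` with `N` acting trivially and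
`m ↦ (G:N) m` bijective on `M`:

* `TrivialAction.natCard_continuousCohomology_one_eq` —
  **`#H¹(G, M) = #{φ ∈ Z¹_cont(N, M) | ∀ g, g·φ = φ}`**, where `Z¹_cont(N, M)` is the tree's
  `contOneCocycles (subgroupRep _ N)` (= continuous homomorphisms `N → M`, `apply_mul`) and
  `(g·φ)(x) = g φ(g⁻¹ x g)` is the tree's cocycle-level conjugation
  (`contOneCocycles.pullback (subgroupConj N g) (conjRepHom _ N g)`);
* `TrivialAction.oneCocycleClass_injective` — `[·] : Z¹_cont(N, M) → H¹(N, M)` is bijective.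

References: J.-P. Serre, *Local Fields* (1979), VII §5–§6 [SerreLocalFields1979]; J.-P. Serre,
*Galois Cohomology* (1997), I §2.4 Prop. 9, I §2.6 (b) [SerreGaloisCohomology1997]; J. S. Milne,
*Arithmetic Duality Theorems* (2006), I §2, proof of Thm. 2.8 [MilneADT2006].
-/

noncomputable section

open CategoryTheory Function
open Literature.NumberTheory.GaloisRepresentations
open Literature.NumberTheory.EllipticCurves (subgroupConj subgroupConj_apply_coe)

universe u

namespace Summit.BirchSwinnertonDyer.Rank1Residual.GaloisImage

namespace TrivialAction

variable {G : Type u} [Group G] [TopologicalSpace G] [IsTopologicalGroup G]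
variable {M : Type u} [AddCommGroup M] [TopologicalSpace M] [DiscreteTopology M]
variable (ρ : ContinuousRep G ℤ M) (N : Subgroup G)

omit [IsTopologicalGroup G] in
/-- For a subgroup `N` acting trivially, a continuous `1`-cocycle `N → M` is a homomorphism:
`φ (x y) = φ x + φ y`. [folklore] -/
theorem apply_mul (htriv : ∀ n ∈ N, ∀ m : M, ρ n m = m)
    (φ : contOneCocycles (subgroupRep ρ.toTopRep N)) (x y : N) :
    φ.1 (x * y) = φ.1 x + φ.1 y := by
  have h := φ.2 x y
  rw [subgroupRep_ρ_apply] at h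
  rw [h]
  exact congrArg _ (htriv x x.2 _)

/-- For a subgroup `N` acting trivially, `[·] : Z¹_cont(N, M) → H¹(N, M)` is injective (the only
principal crossed homomorphism is `0`). [cite: SerreGaloisCohomology1997, I §2.2, I §5.1] -/
theorem oneCocycleClass_injective (htriv : ∀ n ∈ N, ∀ m : M, ρ n m = m) :
    Injective (oneCocycleClass (subgroupRep ρ.toTopRep N)) := by
  intro φ ψ h
  rw [← sub_eq_zero] at h ⊢
  rw [← oneCocycleClass_sub] at h
  obtain ⟨v, hv⟩ := (oneCocycleClass_eq_zero_iff _ _).1 h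
  apply Subtype.ext
  ext x
  rw [hv x, subgroupRep_ρ_apply]
  change ρ (x : G) v - v = 0
  rw [htriv x x.2 v, sub_self]

/-- For a subgroup `N` acting trivially, `[·] : Z¹_cont(N, M) → H¹(N, M)` is bijective.
[cite: SerreGaloisCohomology1997, I §2.2, I §5.1] -/
theorem oneCocycleClass_bijective (htriv : ∀ n ∈ N, ∀ m : M, ρ n m = m) :
    Bijective (oneCocycleClass (subgroupRep ρ.toTopRep N)) :=
  ⟨oneCocycleClass_injective ρ N htriv, oneCocycleClass_surjective _⟩

variable [N.Normal]

/-- The restriction `H¹(G, M) → H¹(N, M)` lands in the `G`-invariant classes, and — when `N` is open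
of finite index with `(G : N)` invertible on the discrete module `M` — is a bijection onto them.
[cite: SerreLocalFields1979, VII §6] [cite: SerreGaloisCohomology1997, I §2.4 Prop. 9] -/
theorem resSubgroup_one_bijective_invariants [Fintype (G ⧸ N)] (hNo : IsOpen (N : Set G))
    (hd : Bijective fun m : M => (N.index : ℤ) • m) :
    Bijective fun x : continuousCohomology 1 ρ.toTopRep =>
      (⟨resSubgroup ρ.toTopRep N 1 x, fun g => conjMap_resSubgroup_one ρ.toTopRep N g x⟩ :
        {y : continuousCohomology 1 (subgroupRep ρ.toTopRep N) // ∀ g : G, conjMap ρ.toTopRep N g 1 y = y}) := by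
  refine ⟨fun a b h => resSubgroup_one_injective_of_bijective N ρ hNo hd (congrArg Subtype.val h),
    fun y => ?_⟩
  obtain ⟨x, hx⟩ := exists_resSubgroup_one_eq_of_bijective N ρ hNo hd y.1 y.2
  exact ⟨x, Subtype.ext hx⟩

/-- **`#H¹(G, M) = #{φ ∈ Z¹_cont(N, M) | g·φ = φ ∀ g}`** for an open normal subgroup `N` of finite
index acting trivially on the discrete `G`-module `M`, with `m ↦ (G:N)·m` bijective on `M`
(`(g·φ)(x) = g φ(g⁻¹ x g)`; the invariant `φ` are the continuous homomorphisms `N → M` with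
`φ(g⁻¹ x g) = g⁻¹ φ(x)`).  Restriction is a bijection onto the `G`-invariant classes (the tree's
`ConjugationDescent`), and classes of `N` are cocycles (`oneCocycleClass_bijective`) compatibly
with the action (`conjMap_oneCocycleClass`). [cite: SerreLocalFields1979, VII §6]
[cite: MilneADT2006, I §2 proof of Thm 2.8] -/
theorem natCard_continuousCohomology_one_eq [Fintype (G ⧸ N)] (hNo : IsOpen (N : Set G))
    (hd : Bijective fun m : M => (N.index : ℤ) • m) (htriv : ∀ n ∈ N, ∀ m : M, ρ n m = m) :
    Nat.card (continuousCohomology 1 ρ.toTopRep) =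
      Nat.card {φ : contOneCocycles (subgroupRep ρ.toTopRep N) //
        ∀ g : G, contOneCocycles.pullback (subgroupConj N g) (conjRepHom ρ.toTopRep N g) φ = φ} := by
  rw [Nat.card_eq_of_bijective _ (resSubgroup_one_bijective_invariants ρ N hNo hd)]
  symm
  refine Nat.card_eq_of_bijective
    (fun φ => ⟨oneCocycleClass _ φ.1, fun g => by
      rw [conjMap_oneCocycleClass, φ.2 g]⟩) ⟨fun φ ψ h => ?_, fun y => ?_⟩
  · exact Subtype.ext (oneCocycleClass_injective ρ N htriv (congrArg Subtype.val h))
  · obtain ⟨φ, hφ⟩ := oneCocycleClass_surjective _ y.1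
    refine ⟨⟨φ, fun g => oneCocycleClass_injective ρ N htriv ?_⟩, Subtype.ext hφ⟩
    rw [← conjMap_oneCocycleClass, hφ, y.2 g]

omit [TopologicalSpace G] [IsTopologicalGroup G] [TopologicalSpace M] [DiscreteTopology M] [N.Normal] in
/-- The index `(G : N)` acts bijectively on a module killed by `p` when `p ∤ (G : N)`. [folklore] -/
theorem bijective_index_smul_of_prime {p : ℕ} [hp : Fact p.Prime] (hpM : ∀ m : M, p • m = 0)
    (hG : ¬ p ∣ N.index) : Bijective fun m : M => (N.index : ℤ) • m := by
  have hcop : Nat.Coprime N.index p := (Nat.Prime.coprime_iff_not_dvd hp.out).2 hG |>.symm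
  obtain ⟨a, b, hab⟩ := Nat.isCoprime_iff_coprime.2 hcop
  have hinv : ∀ m : M, a • ((N.index : ℤ) • m) = m := fun m => by
    rw [smul_smul]
    have h1 : a * (N.index : ℤ) = 1 - b * p := by linarith
    rw [h1, sub_smul, one_smul, mul_smul, natCast_zsmul, hpM, smul_zero, sub_zero]
  have hinv' : ∀ m : M, (N.index : ℤ) • (a • m) = m := fun m => by
    rw [smul_comm]; exact hinv m
  refine ⟨fun m m' h => ?_, fun m => ⟨a • m, hinv' m⟩⟩
  have h' := congrArg (fun x : M => a • x) h
  simp only [hinv] at h'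
  exact h'

end TrivialAction

end Summit.BirchSwinnertonDyer.Rank1Residual.GaloisImage

end
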